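import Literature.AlgebraicGeometry.Markman2025.SecantQuotientPolarization
import Literature.AlgebraicGeometry.HodgeTheory.CartierDivisorChernClassPullback
import Literature.AlgebraicGeometry.HodgeTheory.AmpleDivisorClassHardLefschetz
import Literature.AlgebraicGeometry.Motives.AmpleDivisorBoxProduct
import Literature.AlgebraicGeometry.Motives.TateAbelianFiniteLatticeProofs
import HarnessLib

/-!
# Markman's descended class `h_Y` is the class of an AMPLE divisor on `Y = (A × Â)/Ḡ`

Family `hodge`, layer `Literature/AlgebraicGeometry/Markman2025`; seat `hodge-lit-avcarriers` (ring-2 HONEST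
LIMIT 7). E. Markman, arXiv:2502.03415v2, §1.5 (p. 7) and §3.2: on `X × X̂` (`X = A` an abelian variety
polarised by `Θ`, `X̂ = Pic⁰`) the class `Ξ = p₁^*[Θ] + d·p₂^*[Θ̂]` is the first Chern class of the ample
line bundle `p₁^*Θ ⊗ p₂^*Θ̂^{⊗d}` (§3.2, Cor. 3.2.3: "`(X × X̂, η, Ξ)` is a polarized abelian variety of
Weil type"), and it descends to a polarisation `h` of `Y = (X × X̂)/Ḡ` ("`Ξ` is `Ḡ`-invariant and descends to
an ample class `h` on `Y`", §1.5 p. 7 with Lemma 9.3.11). In the tree `Ξ(θ) = weilPolarizationClass` and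
`h_Y(θ) = secantPolarizationClass` (`SecantQuotientPolarization`) were so far CLASSES only; this file
exhibits the ample DIVISORS: for every polarisation class `θ₀ ∈ ℚˣ·[Θ]` (`AbelianVariety.IsPolarizationClassOf`)
and `d ≥ 1`,

* `exists_isAmple_isPolarizationClassOf_weilPolarizationClass` — an ample Cartier divisor `E` on `A × Â`
  with `Ξ(θ₀) ∈ ℚˣ·[E]`: `E = p₁^*(m²Θ) + p₂^*g^*(dΘ)` for a quasi-inverse `g` of `φ_Θ`
  (`φ_Θ ≫ g = [m]`, Mumford §19), ample as a box product of ample divisors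
  (`AbelianVariety.isAmple_boxProduct`), with class `r·m²/c · Ξ(θ₀)` by the functoriality of `c₁` along the
  dominant morphisms `p₁` and `p₂ ≫ g` (`HodgeModel.exists_ne_zero_chernCharacter_cartierDivisorCocycle_pullback_eq_smul_map`,
  ONE scalar `r` for both) and `g^*θ₀ = m²·θ̂₀` (`complexBetti_map_eq_smul_dualClassOf_of_comp_eq`);
* `exists_isAmple_isPolarizationClassOf_secantPolarizationClass` — an ample Cartier divisor `H` on `Y`
  with `h_Y(θ₀) ∈ ℚˣ·[H]`: `H = r_q^*E` for a quasi-inverse `r_q` of `q` (`q ≫ r_q = [n]`,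
  `r_q^*Ξ = n²·h_Y`), ample as a pull-back along an isogeny;
* hence, by the hard Lefschetz theorem for ample divisor classes (`AmpleDivisorClassHardLefschetz`),
  **`h_Y(θ₀)` is a polarisation class in André's sense** — rational, in `N¹`, hard Lefschetz in dimension
  `dim Y` (`isPolarizationClass_secantPolarizationClass`), and so is the class `θ_X` of every secant-quotient
  anchor `IsSecantQuotientAnchorWith d X θ_X` in dimension `6` (`IsSecantQuotientAnchorWith.isPolarizationClass`).

Everything is proved; no definition and no named fact is introduced. Nothing here asserts HC/HC_AV/VHC or any
part of Markman's Theorem 1.4.1; the file concerns the polarisation of the anchor only.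

## References

* [Markman2025SecantWeil] E. Markman, arXiv:2502.03415v2 (2025), §1.5 (p. 7), §3.2 (p. 15) and Cor. 3.2.3,
  §9.3 Lemma 9.3.11. UNREFEREED PREPRINT — cited for the shape of the objects only.
* [MumfordAV1970] D. Mumford, *Abelian Varieties* (1970), §19 Remark p. 169 (quasi-inverse of an isogeny),
  §6 (ample line bundles on products).
* [Lange2023AbelianVarietiesComplex] H. Lange, *Abelian Varieties over the Complex Numbers* (2023), §2.1.1
  (polarisation `= c₁` of an ample line bundle; induced polarisation).
* [GortzWedhorn2020] U. Görtz, T. Wedhorn, *Algebraic Geometry I* (2020), Prop. 13.50 (4), Prop. 13.66 (2).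
-/

noncomputable section

universe u

open CategoryTheory AlgebraicGeometry

namespace Literature.AlgebraicGeometry.Markman2025

open Literature.AlgebraicGeometry.Motives Literature.AlgebraicGeometry.Motives.AbelianVariety
  Literature.AlgebraicGeometry.HodgeTheory Literature.AlgebraicTopology.SingularHomology

variable (A : AbelianVariety ℂ) {Θ : CartierDivisor A.X.left} (hΘ : Θ.IsAmple)

/-! ## §1 `g^*θ = m²·θ̂` for a quasi-inverse `g` of `φ_Θ` -/

/-- **`g^*θ = m²·θ̂`** for a homomorphism `g : Â ⟶ A` with `φ_Θ ≫ g = [m]_A` (a quasi-inverse of the isogeny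
`φ_Θ`, Mumford §19): `φ_Θ^*(g^*θ) = [m]^*θ = m²θ = φ_Θ^*(m²θ̂)` and `φ_Θ^*` is injective.
[cite: MumfordAV1970, §19 Remark p. 169] [cite: vanGeemen1994HodgeAV, §3.6 (p. 236)] -/
theorem complexBetti_map_eq_smul_dualClassOf_of_comp_eq {g : A.dualOf Θ hΘ ⟶ A} {m : ℕ}
    (hfg : A.phiTheta Θ hΘ ≫ g = m • 𝟙 A) (θ : complexBetti A.X 2) :
    complexBetti.map g.hom.hom.hom 2 θ = ((m : ℂ) ^ 2) • A.dualClassOf hΘ θ := by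
  apply (A.complexBetti_map_phiTheta_bijective hΘ 2).1
  have h1 : complexBetti.map (A.phiTheta Θ hΘ).hom.hom.hom 2 (complexBetti.map g.hom.hom.hom 2 θ) =
      ((m : ℂ) ^ 2) • θ := by
    rw [← complexBetti_map_comp_hom_apply, hfg, ← natCast_zsmul, complexBetti_map_zsmul_hom_apply_eq_pow_smul,
      complexBetti_map_id_hom_apply, Int.cast_natCast]
  change complexBetti.map (A.phiTheta Θ hΘ).hom.hom.hom 2 (complexBetti.map g.hom.hom.hom 2 θ) =
    complexBetti.map (A.phiTheta Θ hΘ).hom.hom.hom 2 (((m : ℂ) ^ 2) • A.dualClassOf hΘ θ)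
  rw [h1, map_smul, A.complexBetti_map_phiTheta_dualClassOf hΘ θ]

/-! ## §2 An ample divisor on `A × Â` with class `Ξ(θ₀)` -/

/-- **`Ξ(θ₀) = p₁^*θ₀ + d·p₂^*θ̂₀` is the class of an AMPLE divisor on `A × Â`** for every polarisation class
`θ₀ ∈ ℚˣ·[Θ]` of the ample `Θ` and `d ≥ 1` — Markman §3.2 / Cor. 3.2.3 (`Ξ = c₁(p₁^*Θ ⊗ p₂^*Θ̂^{⊗d})`,
"`(X × X̂, η, Ξ)` is a polarized abelian variety"). Witness: `E = p₁^*(m²Θ) + p₂^*g^*(dΘ)` for a quasi-inverse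
`g` of `φ_Θ` (`φ_Θ ≫ g = [m]`), ample by `AbelianVariety.isAmple_boxProduct`; its class is computed in ONE Hodge
model of `A × Â` from ONE of `A` along the two dominant morphisms `p₁`, `p₂ ≫ g`
(`HodgeModel.exists_ne_zero_chernCharacter_cartierDivisorCocycle_pullback_eq_smul_map`: the same scalar for both),
with `(p₂ ≫ g)^*θ₀ = m²·p₂^*θ̂₀`. [cite: Markman2025SecantWeil, §3.2 (p. 15) and Cor. 3.2.3]
[cite: Lange2023AbelianVarietiesComplex, §2.1.1 (p. 68)] [cite: MumfordAV1970, §19 Remark p. 169] -/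
theorem exists_isAmple_isPolarizationClassOf_weilPolarizationClass {d : ℕ} (hd : d ≠ 0) {θ₀ : complexBetti A.X 2}
    (hP : A.IsPolarizationClassOf Θ θ₀) :
    ∃ E : CartierDivisor (A.prod (A.dualOf Θ hΘ)).X.left, E.IsAmple ∧
      (A.prod (A.dualOf Θ hΘ)).IsPolarizationClassOf E (weilPolarizationClass A hΘ d θ₀) := by
  -- a quasi-inverse `g` of `φ_Θ`
  obtain ⟨g, m, hm, hfg, hgf⟩ := IsIsogeny.exists_nsmul_inverse_holds (A.isIsogeny_phiTheta hΘ)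
  have hmK : ((m : ℕ) : ℂ) ≠ 0 := Nat.cast_ne_zero.2 hm.ne'
  have hg : IsIsogeny g :=
    isIsogeny_of_comp_eq_of_comp_eq (isIsogeny_nsmul_id_of_cast_ne_zero _ _ hmK)
      (isIsogeny_nsmul_id_of_cast_ne_zero _ _ hmK) hfg hgf
  haveI : IsDominant g.hom.hom.hom.left := hg.isDominant_left
  haveI : IsFinite g.hom.hom.hom.left := hg.2
  haveI := isDominant_fst_left A (A.dualOf Θ hΘ)
  haveI := isDominant_snd_left A (A.dualOf Θ hΘ)
  -- the divisors
  have hd0 : 0 < d := Nat.pos_of_ne_zero hd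
  have hm2 : 0 < m ^ 2 := by positivity
  have hΘ₂ : ((d • Θ).pullback g.hom.hom.hom.left).IsAmple := (hΘ.smul hd0).pullback _
  refine ⟨((m ^ 2) • Θ).pullback (fst A (A.dualOf Θ hΘ)).hom.hom.hom.left +
      ((d • Θ).pullback g.hom.hom.hom.left).pullback (snd A (A.dualOf Θ hΘ)).hom.hom.hom.left,
    isAmple_boxProduct A (A.dualOf Θ hΘ) (hΘ.smul hm2) hΘ₂, ?_⟩
  -- the class
  have hrat := hP.isRationalClass
  have hne := hP.ne_zero
  obtain ⟨M, c, hθ₀⟩ := hP.isDivisorClassLineOf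
  have hc : c ≠ 0 := by
    rintro rfl
    exact hne (by rw [hθ₀, zero_smul])
  have hθ₀' : IsOfHodgeType A.dim A.X 2 1 1 θ₀ := hP.isDivisorClassLineOf.isOfHodgeType isSmoothProjective_holds
  refine ⟨(isRationalClass_isOfHodgeType_weilPolarizationClass A hΘ d hrat hθ₀').1,
    weilPolarizationClass_ne_zero A hΘ d hne, ?_⟩
  obtain ⟨N⟩ := (nonempty_hodgeModel_holds (n := (A.prod (A.dualOf Θ hΘ)).dim)
    (X := (A.prod (A.dualOf Θ hΘ)).X)).nonempty isSmoothProjective_holds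
  obtain ⟨r₁, hr₁0, hr₁⟩ := N.exists_ne_zero_chernCharacter_cartierDivisorCocycle_pullback_eq_smul_map
    isSmoothProjective_holds isSmoothProjective_holds M 1
  -- the composite `p₂ ≫ g : A × Â ⟶ A`
  haveI hψ : IsDominant (snd A (A.dualOf Θ hΘ) ≫ g).hom.hom.hom.left :=
    inferInstanceAs (IsDominant ((snd A (A.dualOf Θ hΘ)).hom.hom.hom.left ≫ g.hom.hom.hom.left))
  -- `E ∼ p₁^*(m²Θ) + (p₂ ≫ g)^*(dΘ)`
  have hsame : (((m ^ 2) • Θ).pullback (fst A (A.dualOf Θ hΘ)).hom.hom.hom.left +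
      ((d • Θ).pullback g.hom.hom.hom.left).pullback (snd A (A.dualOf Θ hΘ)).hom.hom.hom.left).SameDivisor
      (((m ^ 2) • Θ).pullback (fst A (A.dualOf Θ hΘ)).hom.hom.hom.left +
        (d • Θ).pullback (snd A (A.dualOf Θ hΘ) ≫ g).hom.hom.hom.left) :=
    (CartierDivisor.SameDivisor.refl _).add
      (CartierDivisor.pullback_pullback_sameDivisor (d • Θ) g.hom.hom.hom.left
        (snd A (A.dualOf Θ hΘ)).hom.hom.hom.left)
  have hchM : M.chernCharacter (cartierDivisorCocycle M.isAnalytification Θ) 1 = c⁻¹ • θ₀ := by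
    rw [hθ₀, smul_smul, inv_mul_cancel₀ hc, one_smul]
  have hψθ : complexBetti.map (snd A (A.dualOf Θ hΘ) ≫ g).hom.hom.hom 2 θ₀ =
      ((m : ℂ) ^ 2) • complexBetti.map (snd A (A.dualOf Θ hΘ)).hom.hom.hom 2 (A.dualClassOf hΘ θ₀) := by
    rw [complexBetti_map_comp_hom_apply, complexBetti_map_eq_smul_dualClassOf_of_comp_eq A hΘ hfg, map_smul]
  have hr₁' : ∀ (ψ : (A.prod (A.dualOf Θ hΘ)).X ⟶ A.X) [IsDominant ψ.left] (D : CartierDivisor A.X.left),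
      N.chernCharacter (cartierDivisorCocycle N.isAnalytification (D.pullback ψ.left)) 1 =
        r₁ • complexBetti.map ψ 2 (M.chernCharacter (cartierDivisorCocycle M.isAnalytification D) 1) :=
    fun ψ _ D ↦ hr₁ ψ D
  have hE : N.chernCharacter (cartierDivisorCocycle N.isAnalytification
      (((m ^ 2) • Θ).pullback (fst A (A.dualOf Θ hΘ)).hom.hom.hom.left +
        ((d • Θ).pullback g.hom.hom.hom.left).pullback (snd A (A.dualOf Θ hΘ)).hom.hom.hom.left)) 1 =
      (r₁ * (m : ℂ) ^ 2 * c⁻¹) • weilPolarizationClass A hΘ d θ₀ := by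
    rw [N.chernCharacter_cartierDivisorCocycle_eq_of_linEquiv hsame.linEquiv, N.chernCharacter_cartierDivisorCocycle_add,
      hr₁' (fst A (A.dualOf Θ hΘ)).hom.hom.hom ((m ^ 2) • Θ), hr₁' (snd A (A.dualOf Θ hΘ) ≫ g).hom.hom.hom (d • Θ),
      M.chernCharacter_cartierDivisorCocycle_smul, M.chernCharacter_cartierDivisorCocycle_smul, hchM,
      weilPolarizationClass_eq, map_smul, map_smul, map_smul, map_smul, hψθ]
    simp only [smul_add, smul_smul, Nat.cast_pow]
    module
  refine ⟨N, c * (r₁ * (m : ℂ) ^ 2)⁻¹, ?_⟩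
  have hr₁m : r₁ * (m : ℂ) ^ 2 ≠ 0 := mul_ne_zero hr₁0 (pow_ne_zero 2 hmK)
  rw [hE, smul_smul, show c * (r₁ * (m : ℂ) ^ 2)⁻¹ * (r₁ * (m : ℂ) ^ 2 * c⁻¹) = 1 by field_simp, one_smul]

/-! ## §3 An ample divisor on `Y = (A × Â)/Ḡ` with class `h_Y(θ₀)` -/

variable (G₁ G₂ : Subgroup (A.Points ℂ)) {n : ℕ} (hn : n ≠ 0) (h₁ : G₁ ≤ A.torsionPoints ℂ n)
  (h₂ : G₂ ≤ A.torsionPoints ℂ n)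

/-- **`h_Y(θ₀)` is the class of an AMPLE divisor on `Y = (A × Â)/Ḡ`** ("`Ξ` descends to an ample class `h` on
`Y`", Markman §1.5 p. 7, with Lemma 9.3.11): `H = r_q^*E` for the ample `E` on `A × Â` with `Ξ(θ₀) ∈ ℚˣ·[E]`
(`exists_isAmple_isPolarizationClassOf_weilPolarizationClass`) and a quasi-inverse `r_q : Y ⟶ A × Â` of the
quotient isogeny `q` (`q ≫ r_q = [n]`; `r_q^*Ξ = n²·h_Y`, `complexBetti_map_weilPolarizationClass_of_comp_eq`):
`H` is ample as the pull-back of an ample divisor along an isogeny (finite, surjective; Görtz–Wedhorn I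
Prop. 13.66 (2)), and `c₁(𝒪(H)) = r·r_q^*c₁(𝒪(E))` (`IsPolarizationClassOf.map_of_isIsogeny`).
[cite: Markman2025SecantWeil, §1.5 (p. 7: Ξ descends to an ample class h on Y) and §9.3 Lemma 9.3.11]
[cite: MumfordAV1970, §19 Remark p. 169] [cite: GortzWedhorn2020, Prop. 13.66 (2) (p. 509)] -/
theorem exists_isAmple_isPolarizationClassOf_secantPolarizationClass {d : ℕ} (hd : d ≠ 0)
    {θ₀ : complexBetti A.X 2} (hP : A.IsPolarizationClassOf Θ θ₀) :
    ∃ H : CartierDivisor (secantQuotient A hΘ G₁ G₂ hn h₁ h₂).X.left, H.IsAmple ∧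
      (secantQuotient A hΘ G₁ G₂ hn h₁ h₂).IsPolarizationClassOf H
        (secantPolarizationClass A hΘ G₁ G₂ hn h₁ h₂ d θ₀) := by
  obtain ⟨E, hE, hEΞ⟩ := exists_isAmple_isPolarizationClassOf_weilPolarizationClass A hΘ hd hP
  -- a quasi-inverse `r` of `q`
  obtain ⟨r, hr⟩ := exists_secantQuotientMap_comp_eq_zsmul_id A hΘ G₁ G₂ hn h₁ h₂
  have hr' := comp_secantQuotientMap_eq_zsmul_id_of_comp_eq hr
  have hnK : ((n : ℕ) : ℂ) ≠ 0 := Nat.cast_ne_zero.2 hn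
  have hrI : IsIsogeny r :=
    isIsogeny_of_comp_eq_of_comp_eq (h := secantQuotientMap A hΘ G₁ G₂ hn h₁ h₂)
      (isIsogeny_nsmul_id_of_cast_ne_zero _ _ hnK) (isIsogeny_nsmul_id_of_cast_ne_zero _ _ hnK)
      (by rw [hr, natCast_zsmul]) (by rw [hr', natCast_zsmul])
  haveI : IsDominant r.hom.hom.hom.left := hrI.isDominant_left
  haveI : IsFinite r.hom.hom.hom.left := hrI.2
  refine ⟨E.pullback r.hom.hom.hom.left, hE.pullback _, ?_⟩
  -- `r^*Ξ = n²·h_Y` is a polarisation class of `r^*E`; rescale by `n⁻²`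
  have hmap := hEΞ.map_of_isIsogeny hrI
  rw [complexBetti_map_weilPolarizationClass_of_comp_eq d hr θ₀] at hmap
  have key := hmap.smul (q := ((n : ℚ) ^ 2)⁻¹) (inv_ne_zero (pow_ne_zero 2 (Nat.cast_ne_zero.2 hn)))
  have hcast : ((((n : ℚ) ^ 2)⁻¹ : ℚ) : ℂ) = ((n : ℂ) ^ 2)⁻¹ := by push_cast; rfl
  rw [hcast, smul_smul, inv_mul_cancel₀ (pow_ne_zero 2 hnK), one_smul] at key
  exact key

/-! ## §4 `h_Y` and the anchor classes are polarisation classes in André's sense (hard Lefschetz) -/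

/-- **`h_Y(θ₀)` is a polarisation class of `Y` in André's sense** — rational, in `N¹H²`, hard Lefschetz in
dimension `dim Y` (`IsPolarizationClass`): it lies on `ℚˣ·[H]` for an ample divisor `H` on `Y`
(`exists_isAmple_isPolarizationClassOf_secantPolarizationClass`) and ample divisor classes satisfy hard
Lefschetz (`IsPolarizationClassOf.isPolarizationClass`, Voisin Thm. 6.25). Markman §1.5 (p. 7): "an ample class
`h` on `Y`". [cite: Markman2025SecantWeil, §1.5 (p. 7)] [cite: VoisinHodgeI2002, Thm. 6.25] -/
theorem isPolarizationClass_secantPolarizationClass {d : ℕ} (hd : d ≠ 0) {θ₀ : complexBetti A.X 2}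
    (hP : A.IsPolarizationClassOf Θ θ₀) :
    IsPolarizationClass (secantQuotient A hΘ G₁ G₂ hn h₁ h₂).dim (secantQuotient A hΘ G₁ G₂ hn h₁ h₂).X
      (secantPolarizationClass A hΘ G₁ G₂ hn h₁ h₂ d θ₀) := by
  obtain ⟨H, hH, hHc⟩ := exists_isAmple_isPolarizationClassOf_secantPolarizationClass A hΘ G₁ G₂ hn h₁ h₂ hd hP
  exact hHc.isPolarizationClass hH

variable {A hΘ G₁ G₂ hn h₁ h₂}

/-- **The class `θ_X` of a secant-quotient anchor `(X, θ_X)` (`IsSecantQuotientAnchorWith d X θ_X`, `d ≥ 1`) is a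
polarisation class in André's sense in dimension `6`**: `θ_X = e^*h_Y(θ)` along the chart `e : X ≅ (J × Ĵ)/Ḡ`,
`h_Y(θ)` is one in dimension `dim Y = 2·dim J = 6` (`isPolarizationClass_secantPolarizationClass`), and the
notion transports along isomorphisms (`IsPolarizationClass.map_of_iso`). So the hard-Lefschetz clause of the
ring-2 anchor predicates is a CONSEQUENCE of the envelope. [cite: Markman2025SecantWeil, §1.5 (p. 7)]
[cite: VoisinHodgeI2002, Thm. 6.25] -/
theorem IsSecantQuotientAnchorWith.isPolarizationClass {d : ℕ} {X : SchemeOver ℂ} {θX : complexBetti X 2}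
    (h : IsSecantQuotientAnchorWith d X θX) (hd : d ≠ 0) : IsPolarizationClass 6 X θX := by
  have hX := h.isSmoothProjective
  obtain ⟨C, hC, 𝒥, h3, Θ, hR, hP, θ, hθ, G₁, G₂, h₁, h₂, hc₁, hn₁, hc₂, hn₂, hbot, e, rfl⟩ := h
  have h6 : (secantQuotient 𝒥.J hP.isAmple G₁ G₂ (Nat.succ_ne_zero d) h₁ h₂).dim = 6 := by
    rw [dim_secantQuotient', h3]
  have hY := isPolarizationClass_secantPolarizationClass 𝒥.J hP.isAmple G₁ G₂ (Nat.succ_ne_zero d) h₁ h₂ hd hθ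
  rw [h6] at hY
  exact hY.map_of_iso isSmoothProjective_holds hX e

end Literature.AlgebraicGeometry.Markman2025

end
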